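import Mathlib

/-!
# Jacobian of the flattening move (helper of the algebraic-area layer of `PlanarK0Injective`)

Helper of the unconditional algebraic-area layer of crux stmt-KontsevichZagierPeriods-9847
(`PlanarK0Injective`, route SymplecticScissors, line lead seat c5). Each band
`{g x < y < g x + w x}` over a good base interval is flattened by the map
`Ψ (x, y) = (F x, (y − g x + c x) / ℓ x)`, where `ℓ` is the total fibre length and `c` the
cumulated width of the lower bands. Here we compute `DΨ` at a point `q = (x, y)` from the
derivatives `F'`, `g'`, `c'`, `ℓ'` of the data at `x` (with `ℓ x ≠ 0`): it is the lower-triangular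
continuous linear map `v ↦ (F' v₀, a v₀ + v₁ / ℓ x)` with
`a = (c' − g') / ℓ x − (y − g x + c x) ℓ' / (ℓ x)²`, so that `det DΨ = F' / ℓ x`.
-/

namespace Summit.KontsevichZagierPeriods.SymplecticScissors.PlanarK0InjectiveAlgebraicLayer

/-- The determinant of the lower-triangular continuous linear map `v ↦ (a v₀, b v₀ + d v₁)` of
`ℝ²` is `a d` (`LinearMap.det_toMatrix'`, `Matrix.det_fin_two`). [folklore] -/
private theorem det_pi_lowerTriangular (a b d : ℝ) :
    (ContinuousLinearMap.pi
        ![a • ContinuousLinearMap.proj (R := ℝ) (φ := fun _ : Fin 2 => ℝ) 0,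
          b • ContinuousLinearMap.proj (R := ℝ) (φ := fun _ : Fin 2 => ℝ) 0 +
            d • ContinuousLinearMap.proj (R := ℝ) (φ := fun _ : Fin 2 => ℝ) 1]).det = a * d := by
  rw [ContinuousLinearMap.det, ← LinearMap.det_toMatrix', Matrix.det_fin_two]
  simp [LinearMap.toMatrix'_apply]

/-- **Jacobian of the flattening move.** If `F`, `g`, `c`, `ℓ` have derivatives `F'`, `g'`, `c'`,
`ℓ'` at `q 0` and `ℓ (q 0) ≠ 0`, then the flattening map
`p ↦ (F (p 0), (p 1 − g (p 0) + c (p 0)) / ℓ (p 0))` is differentiable at `q`, with a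
(lower-triangular) derivative `L` of determinant `F' / ℓ (q 0)`: the first coordinate is
`F ∘ pr₀` (chain rule, derivative `F' pr₀`), the second is the product of
`pr₁ − g ∘ pr₀ + c ∘ pr₀` and `ℓ⁻¹ ∘ pr₀`, whose derivative has `pr₁`-coefficient `1 / ℓ (q 0)`;
the two coordinates are assembled by `hasFDerivAt_pi''`, and
`det [[F', 0], [∗, 1 / ℓ (q 0)]] = F' / ℓ (q 0)`. [folklore] -/
theorem exists_hasFDerivAt_flatten {F g c ℓ : ℝ → ℝ} {F' g' c' ℓ' : ℝ} {q : Fin 2 → ℝ}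
    (hF : HasDerivAt F F' (q 0)) (hg : HasDerivAt g g' (q 0)) (hc : HasDerivAt c c' (q 0))
    (hℓ : HasDerivAt ℓ ℓ' (q 0)) (hℓ0 : ℓ (q 0) ≠ 0) :
    ∃ L : (Fin 2 → ℝ) →L[ℝ] (Fin 2 → ℝ),
      HasFDerivAt (fun p : Fin 2 → ℝ => (![F (p 0), (p 1 - g (p 0) + c (p 0)) / ℓ (p 0)] : Fin 2 → ℝ))
        L q ∧ L.det = F' / ℓ (q 0) := by
  -- the two coordinate projections and their derivatives
  have h0 : HasFDerivAt (fun p : Fin 2 → ℝ => p 0)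
      (ContinuousLinearMap.proj (R := ℝ) (φ := fun _ : Fin 2 => ℝ) 0) q := hasFDerivAt_apply 0 q
  have h1 : HasFDerivAt (fun p : Fin 2 → ℝ => p 1)
      (ContinuousLinearMap.proj (R := ℝ) (φ := fun _ : Fin 2 => ℝ) 1) q := hasFDerivAt_apply 1 q
  -- first coordinate: `F ∘ pr₀`
  have hA : HasFDerivAt (fun p : Fin 2 → ℝ => F (p 0))
      (F' • ContinuousLinearMap.proj (R := ℝ) (φ := fun _ : Fin 2 => ℝ) 0) q :=
    hF.comp_hasFDerivAt q h0
  -- second coordinate: `(pr₁ − g ∘ pr₀ + c ∘ pr₀) · (ℓ ∘ pr₀)⁻¹`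
  have hG : HasFDerivAt (fun p : Fin 2 → ℝ => g (p 0))
      (g' • ContinuousLinearMap.proj (R := ℝ) (φ := fun _ : Fin 2 => ℝ) 0) q :=
    hg.comp_hasFDerivAt q h0
  have hCc : HasFDerivAt (fun p : Fin 2 → ℝ => c (p 0))
      (c' • ContinuousLinearMap.proj (R := ℝ) (φ := fun _ : Fin 2 => ℝ) 0) q :=
    hc.comp_hasFDerivAt q h0
  have hN : HasFDerivAt (fun p : Fin 2 → ℝ => p 1 - g (p 0) + c (p 0))
      (ContinuousLinearMap.proj (R := ℝ) (φ := fun _ : Fin 2 => ℝ) 1 -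
          g' • ContinuousLinearMap.proj (R := ℝ) (φ := fun _ : Fin 2 => ℝ) 0 +
        c' • ContinuousLinearMap.proj (R := ℝ) (φ := fun _ : Fin 2 => ℝ) 0) q :=
    (h1.sub hG).add hCc
  have hψ : HasDerivAt (fun t : ℝ => (ℓ t)⁻¹) (-ℓ' / ℓ (q 0) ^ 2) (q 0) := hℓ.fun_inv hℓ0
  have hB : HasFDerivAt (fun p : Fin 2 → ℝ => (ℓ (p 0))⁻¹)
      ((-ℓ' / ℓ (q 0) ^ 2) • ContinuousLinearMap.proj (R := ℝ) (φ := fun _ : Fin 2 => ℝ) 0) q :=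
    HasDerivAt.comp_hasFDerivAt (h₂ := fun t : ℝ => (ℓ t)⁻¹) (f := fun p : Fin 2 → ℝ => p 0)
      q hψ h0
  have hC := hN.mul hB
  -- the nice lower-triangular form of the derivative of the second coordinate
  have hC' : HasFDerivAt (fun p : Fin 2 → ℝ => (p 1 - g (p 0) + c (p 0)) / ℓ (p 0))
      (((c' - g') / ℓ (q 0) + (q 1 - g (q 0) + c (q 0)) * (-ℓ' / ℓ (q 0) ^ 2)) •
          ContinuousLinearMap.proj (R := ℝ) (φ := fun _ : Fin 2 => ℝ) 0 +
        (ℓ (q 0))⁻¹ • ContinuousLinearMap.proj (R := ℝ) (φ := fun _ : Fin 2 => ℝ) 1) q := by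
    have e : (fun p : Fin 2 → ℝ => (p 1 - g (p 0) + c (p 0)) / ℓ (p 0)) =
        fun p => (p 1 - g (p 0) + c (p 0)) * (ℓ (p 0))⁻¹ :=
      funext fun p => div_eq_mul_inv _ _
    rw [e]
    refine hC.congr_fderiv (ContinuousLinearMap.ext fun v => ?_)
    simp only [add_apply, smul_apply, sub_apply, ContinuousLinearMap.proj_apply, smul_eq_mul]
    ring
  refine ⟨ContinuousLinearMap.pi
    ![F' • ContinuousLinearMap.proj (R := ℝ) (φ := fun _ : Fin 2 => ℝ) 0,
      ((c' - g') / ℓ (q 0) + (q 1 - g (q 0) + c (q 0)) * (-ℓ' / ℓ (q 0) ^ 2)) •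
          ContinuousLinearMap.proj (R := ℝ) (φ := fun _ : Fin 2 => ℝ) 0 +
        (ℓ (q 0))⁻¹ • ContinuousLinearMap.proj (R := ℝ) (φ := fun _ : Fin 2 => ℝ) 1], ?_, ?_⟩
  · refine hasFDerivAt_pi'' (Fin.forall_fin_two.mpr ⟨?_, ?_⟩)
    · rw [ContinuousLinearMap.proj_pi]
      simp only [Matrix.cons_val_zero]
      exact hA
    · rw [ContinuousLinearMap.proj_pi]
      simp only [Matrix.cons_val_one, Matrix.cons_val_fin_one]
      exact hC'
  · rw [det_pi_lowerTriangular, div_eq_mul_inv]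

/-- **Registered-stub anchor** (closed form of `exists_hasFDerivAt_flatten`, the stub `Flatten` of
the algebraic-area layer of crux stmt-KontsevichZagierPeriods-9847): the flattening map
`p ↦ (F (p 0), (p 1 − g (p 0) + c (p 0)) / ℓ (p 0))` has at `q` a derivative of determinant
`F' / ℓ (q 0)`. [folklore] -/
theorem helper_algebraicLayer_flatten :
    ∀ (F g c ℓ : ℝ → ℝ) (F' g' c' ℓ' : ℝ) (q : Fin 2 → ℝ), HasDerivAt F F' (q 0) →
      HasDerivAt g g' (q 0) → HasDerivAt c c' (q 0) → HasDerivAt ℓ ℓ' (q 0) → ℓ (q 0) ≠ 0 →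
      ∃ L : (Fin 2 → ℝ) →L[ℝ] (Fin 2 → ℝ),
        HasFDerivAt (fun p : Fin 2 → ℝ => (![F (p 0), (p 1 - g (p 0) + c (p 0)) / ℓ (p 0)] : Fin 2 → ℝ))
          L q ∧ L.det = F' / ℓ (q 0) :=
  fun _ _ _ _ _ _ _ _ _ hF hg hc hℓ hℓ0 => exists_hasFDerivAt_flatten hF hg hc hℓ hℓ0

end Summit.KontsevichZagierPeriods.SymplecticScissors.PlanarK0InjectiveAlgebraicLayer
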